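import Mathlib
import Summits.AtomisticToContinuum.HydrodynamicLimit.Theses.ImplosionDichotomy
import Summits.AtomisticToContinuum.HydrodynamicLimit.Theorems.ImplosionDichotomyDenseExcursionKidderKnob
import Literature.Analysis.FluidPDE.CompressibleEulerImplosion

/-!
# The smooth monatomic profile `SS(r₂)` in the variables of line `r2-one-mode-two-conditions`
# (crux `DenseExcursion`, stub `stub_profile`)

Helper file (`--supports stmt-AtomisticToContinuum-12586`) for the registered stub `stub_profile` of the
line `Cruxes/DenseExcursion/Lines/r2-one-mode-two-conditions.lean` (v2 skeleton, sha 89376ea6) of the crux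
`Summit.AtomisticToContinuum.HydrodynamicLimit.Theses.ImplosionDichotomy.DenseExcursion`:

  `BuckmasterCaolaboraGomezserrano2025_thm11_monatomic → ∃ r W S, (11/10 < r ∧ r < 227/200) ∧ IsMonatomicProfile r W S`.

The definitions `Delta`, `Delta1`, `Delta2`, `IsMonatomicProfile` are COPIED VERBATIM from the skeleton's §0
(so the statement transfers by `Iff.rfl`).

**Mathematics.** The named fact (Buckmaster–Cao-Labora–Gómez-Serrano 2025, Thm 1.1 at `γ = 5/3`) gives a
speed `r ∈ (1.10102, 1.13476)` and radial profiles `U, S_BCG` of `ζ = R/(T-t)^{1/r}`, smooth as the fields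
`y ↦ (U |y|/|y|) y`, `y ↦ S_BCG |y|` on `ℝ³`, with, for `ζ > 0`,
`(r-1)U + (ζ+U)U' + (1/3) S S' = 0`, `(r-1)S + (ζ+U)S' + (1/3)S(U' + 2U/ζ) = 0`, `S_BCG > 0` on `[0,∞)`,
`U/ζ, S_BCG/ζ → 0` at infinity. Put `x = log ζ` and
`W(x) = -U(eˣ)/eˣ`, `S(x) = S_BCG(eˣ)/(3eˣ)` (`wOf U`, `sOf S_BCG`). Then `U' = -(W + W_x)`,
`S_BCG' = 3(S + S_x)`, and the two equations divided by `ζ` (resp. `3ζ`) are the momentum and mass equations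
`(W-1)W_x + 3SS_x = rW - W² - 3S²`, `(1-W)S_x - (S/3)W_x = S(2W - r)`, whose solved form (Cramer, determinant
`-Δ`) is `Δ W_x = -Δ₁`, `Δ S_x = -Δ₂`. Smoothness of `W, S` on `ℝ`: restrict the smooth fields to the ray
`x ↦ eˣ e₀`. Centre regularity: `F y = -((U|y|/|y|) y)`, `G y = S_BCG|y|/3`, `G 0 = S_BCG(0)/3 > 0`. Far field
from `U/ζ, S_BCG/ζ → 0` composed with `exp → ∞`. Window: `(1.10102, 1.13476) ⊂ (11/10, 227/200)` and
`227/200 < 3 - √3` (`3 < (3 - 227/200)²`).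
-/

noncomputable section

open Set Filter Topology
open scoped ContDiff

namespace Summit.AtomisticToContinuum.HydrodynamicLimit.Theorems.R2OneModeTwoConditions

open Literature.MathematicalPhysics.KineticTheory (V3)
open Summit.AtomisticToContinuum.HydrodynamicLimit.Theorems.KidderKnobMelnikov
  (norm_smul_unitVec smul_unitVec_apply_zero differentiableAt_of_radialScalar
    differentiableAt_of_radialField)

/-! ## The line-posited definitions (verbatim: skeleton `r2-one-mode-two-conditions.lean` v2, §0) -/

/-- `Δ = (1 - W)² - S²` of the `(d, ℓ) = (3, 3)` self-similar phase portrait (sonic line `S = 1 - W`). -/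
def Delta (S W : ℝ) : ℝ := (1 - W) ^ 2 - S ^ 2

/-- `Δ₁ = W (W - 1)(W - r) - 3 (W - (r - 1)) S²` for `(d, ℓ) = (3, 3)`. -/
def Delta1 (r S W : ℝ) : ℝ := W * (W - 1) * (W - r) - 3 * (W - (r - 1)) * S ^ 2

/-- `Δ₂ = S (5 W² - (6 + 2 r) W + 3 r - 3 S²) / 3` for `(d, ℓ) = (3, 3)`. -/
def Delta2 (r S W : ℝ) : ℝ := S * (5 * W ^ 2 - (6 + 2 * r) * W + 3 * r - 3 * S ^ 2) / 3

/-- A GLOBALLY SMOOTH self-similar implosion profile of the monatomic gas with blow-up speed `r`: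
`W, S` are `C^∞` functions of `x = log y ∈ ℝ` solving `Δ W' = -Δ₁`, `Δ S' = -Δ₂` (polynomial form,
so smoothness ACROSS the sonic point is part of the definition and quantises `r`), `S > 0`, regular
at the centre (v2 form: the radial fields `y ↦ W(log ‖y‖) y` — the velocity direction field — and
`y ↦ ‖y‖ S(log ‖y‖)` — the sound speed — extend to `C^∞` fields `F`, `G` on `ℝ³` with `G 0 > 0`; equivalently
`W` and `y S` are smooth functions of `y²`), and tending to the far-field point `(S, W) = (0, 0)` as
`x → +∞`; `1 < r < r* = 3 - √3`. -/
def IsMonatomicProfile (r : ℝ) (W S : ℝ → ℝ) : Prop :=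
  1 < r ∧ r < 3 - Real.sqrt 3 ∧
  ContDiff ℝ ∞ W ∧ ContDiff ℝ ∞ S ∧ (∀ x, 0 < S x) ∧
  (∀ x, Delta (S x) (W x) * deriv W x = -Delta1 r (S x) (W x) ∧
        Delta (S x) (W x) * deriv S x = -Delta2 r (S x) (W x)) ∧
  (∃ (F : V3 → V3) (G : V3 → ℝ), ContDiff ℝ ∞ F ∧ ContDiff ℝ ∞ G ∧ 0 < G 0 ∧
      ∀ y : V3, y ≠ 0 → W (Real.log ‖y‖) • y = F y ∧ ‖y‖ * S (Real.log ‖y‖) = G y) ∧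
  Tendsto W atTop (𝓝 0) ∧ Tendsto S atTop (𝓝 0)

/-! ## The change of variables `x = log ζ` -/

/-- `W(x) = -U(eˣ)/eˣ`: the line's `W`-profile (`u = -R W/(r(T-t))`) of the BCG radial velocity profile `U`
(`u = r⁻¹ (T-t)^{1/r-1} U(ζ)`, `ζ = R/(T-t)^{1/r} = eˣ`). -/
def wOf (U : ℝ → ℝ) (x : ℝ) : ℝ := -U (Real.exp x) / Real.exp x

/-- `S(x) = S_BCG(eˣ)/(3eˣ)`: the line's `S`-profile (`c = R S/(r(T-t))`) of the BCG rescaled sound speed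
`S_BCG` (`σ = α⁻¹ c = 3c = r⁻¹ (T-t)^{1/r-1} S_BCG(ζ)`). -/
def sOf (S : ℝ → ℝ) (x : ℝ) : ℝ := S (Real.exp x) / (3 * Real.exp x)

/-- Along the ray `x ↦ eˣ e₀` the radial velocity field reads off `U(eˣ)` in the first coordinate. [folklore] -/
theorem radialField_ray (U : ℝ → ℝ) (x : ℝ) :
    ((U ‖Real.exp x • (EuclideanSpace.single 0 1 : V3)‖ / ‖Real.exp x • (EuclideanSpace.single 0 1 : V3)‖) •
        (Real.exp x • (EuclideanSpace.single 0 1 : V3))) 0 = U (Real.exp x) := by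
  rw [smul_smul, smul_unitVec_apply_zero, norm_smul_unitVec (Real.exp_pos x).le,
    div_mul_cancel₀ _ (Real.exp_pos x).ne']

/-- `x ↦ U(eˣ)` is smooth when the radial vector field `y ↦ (U|y|/|y|) y` is smooth on `ℝ³`. [folklore] -/
theorem contDiff_comp_exp_of_radialField {U : ℝ → ℝ}
    (hU : ContDiff ℝ ∞ (fun y : V3 => (U ‖y‖ / ‖y‖) • y)) :
    ContDiff ℝ ∞ (fun x => U (Real.exp x)) := by
  have h1 : ContDiff ℝ ∞ (fun x : ℝ => Real.exp x • (EuclideanSpace.single 0 1 : V3)) :=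
    Real.contDiff_exp.smul contDiff_const
  have h2 : ContDiff ℝ ∞ (fun x : ℝ =>
      ((U ‖Real.exp x • (EuclideanSpace.single 0 1 : V3)‖ / ‖Real.exp x • (EuclideanSpace.single 0 1 : V3)‖) •
        (Real.exp x • (EuclideanSpace.single 0 1 : V3))) 0) :=
    (contDiff_piLp 2).1 (hU.comp h1) 0
  have h3 : (fun x : ℝ =>
      ((U ‖Real.exp x • (EuclideanSpace.single 0 1 : V3)‖ / ‖Real.exp x • (EuclideanSpace.single 0 1 : V3)‖) •
        (Real.exp x • (EuclideanSpace.single 0 1 : V3))) 0) = fun x => U (Real.exp x) :=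
    funext fun x => radialField_ray U x
  rw [← h3]
  exact h2

/-- `x ↦ S(eˣ)` is smooth when the radial scalar field `y ↦ S|y|` is smooth on `ℝ³`. [folklore] -/
theorem contDiff_comp_exp_of_radialScalar {S : ℝ → ℝ} (hS : ContDiff ℝ ∞ (fun y : V3 => S ‖y‖)) :
    ContDiff ℝ ∞ (fun x => S (Real.exp x)) := by
  have h1 : ContDiff ℝ ∞ (fun x : ℝ => Real.exp x • (EuclideanSpace.single 0 1 : V3)) :=
    Real.contDiff_exp.smul contDiff_const
  have h2 : ContDiff ℝ ∞ (fun x : ℝ => S ‖Real.exp x • (EuclideanSpace.single 0 1 : V3)‖) := hS.comp h1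
  have h3 : (fun x : ℝ => S ‖Real.exp x • (EuclideanSpace.single 0 1 : V3)‖) = fun x => S (Real.exp x) :=
    funext fun x => by rw [norm_smul_unitVec (Real.exp_pos x).le]
  rw [← h3]
  exact h2

/-- `W = wOf U` is smooth on `ℝ`. [folklore] -/
theorem contDiff_wOf {U : ℝ → ℝ} (hU : ContDiff ℝ ∞ (fun y : V3 => (U ‖y‖ / ‖y‖) • y)) :
    ContDiff ℝ ∞ (wOf U) :=
  (contDiff_comp_exp_of_radialField hU).neg.div Real.contDiff_exp fun x => (Real.exp_pos x).ne'

/-- `S = sOf S_BCG` is smooth on `ℝ`. [folklore] -/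
theorem contDiff_sOf {S : ℝ → ℝ} (hS : ContDiff ℝ ∞ (fun y : V3 => S ‖y‖)) : ContDiff ℝ ∞ (sOf S) :=
  (contDiff_comp_exp_of_radialScalar hS).div (contDiff_const.mul Real.contDiff_exp) fun x =>
    mul_ne_zero three_ne_zero (Real.exp_pos x).ne'

/-- `W_x = (-(U'(ζ) ζ) ζ + U(ζ) ζ)/ζ²` at `ζ = eˣ` (chain and quotient rule). [folklore] -/
theorem deriv_wOf {U : ℝ → ℝ} {x : ℝ} (hU : DifferentiableAt ℝ U (Real.exp x)) :
    deriv (wOf U) x =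
      (-(deriv U (Real.exp x) * Real.exp x) * Real.exp x - -U (Real.exp x) * Real.exp x) /
        Real.exp x ^ 2 := by
  have h1 : HasDerivAt (fun y => U (Real.exp y)) (deriv U (Real.exp x) * Real.exp x) x :=
    hU.hasDerivAt.comp x (Real.hasDerivAt_exp x)
  exact (h1.neg.div (Real.hasDerivAt_exp x) (Real.exp_pos x).ne').deriv

/-- `S_x = ((S'(ζ) ζ)(3ζ) - S(ζ)(3ζ))/(3ζ)²` at `ζ = eˣ` (chain and quotient rule). [folklore] -/
theorem deriv_sOf {S : ℝ → ℝ} {x : ℝ} (hS : DifferentiableAt ℝ S (Real.exp x)) :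
    deriv (sOf S) x =
      (deriv S (Real.exp x) * Real.exp x * (3 * Real.exp x) - S (Real.exp x) * (3 * Real.exp x)) /
        (3 * Real.exp x) ^ 2 := by
  have h1 : HasDerivAt (fun y => S (Real.exp y)) (deriv S (Real.exp x) * Real.exp x) x :=
    hS.hasDerivAt.comp x (Real.hasDerivAt_exp x)
  exact (h1.div ((Real.hasDerivAt_exp x).const_mul 3) (mul_ne_zero three_ne_zero (Real.exp_pos x).ne')).deriv

/-- PURE ALGEBRA (Cramer with determinant `-Δ`): the momentum and mass equations
`(W-1)W' + 3SS' = rW - W² - 3S²`, `(1-W)S' - (S/3)W' = S(2W - r)` in solved form are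
`Δ W' = -Δ₁`, `Δ S' = -Δ₂`. [folklore] -/
theorem solved_form_of_profileEqs (r W W' S S' : ℝ)
    (hM : (W - 1) * W' + 3 * S * S' = r * W - W ^ 2 - 3 * S ^ 2)
    (hC : (1 - W) * S' - S / 3 * W' = S * (2 * W - r)) :
    Delta S W * W' = -Delta1 r S W ∧ Delta S W * S' = -Delta2 r S W := by
  unfold Delta Delta1 Delta2
  constructor
  · linear_combination (W - 1) * hM + 3 * S * hC
  · linear_combination (-(S / 3)) * hM + (1 - W) * hC

/-- THE PROFILE EQUATIONS IN THE LINE'S VARIABLES. If `U, S` solve the BCG profile system at `ζ = eˣ > 0`,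
then `W = wOf U`, `S = sOf S` satisfy `Δ W' = -Δ₁`, `Δ S' = -Δ₂` at `x`. [folklore] -/
theorem profileEqs_of_bcg {r : ℝ} {U S : ℝ → ℝ} {x : ℝ}
    (hU : DifferentiableAt ℝ U (Real.exp x)) (hS : DifferentiableAt ℝ S (Real.exp x))
    (h1 : (r - 1) * U (Real.exp x) + (Real.exp x + U (Real.exp x)) * deriv U (Real.exp x) +
        1 / 3 * S (Real.exp x) * deriv S (Real.exp x) = 0)
    (h2 : (r - 1) * S (Real.exp x) + (Real.exp x + U (Real.exp x)) * deriv S (Real.exp x) +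
        1 / 3 * S (Real.exp x) * (deriv U (Real.exp x) + 2 * U (Real.exp x) / Real.exp x) = 0) :
    Delta (sOf S x) (wOf U x) * deriv (wOf U) x = -Delta1 r (sOf S x) (wOf U x) ∧
      Delta (sOf S x) (wOf U x) * deriv (sOf S) x = -Delta2 r (sOf S x) (wOf U x) := by
  have hζ : Real.exp x ≠ 0 := (Real.exp_pos x).ne'
  rw [deriv_wOf hU, deriv_sOf hS]
  apply solved_form_of_profileEqs
  · -- momentum = (BCG eq. 1)/ζ
    have key : (wOf U x - 1) *
          ((-(deriv U (Real.exp x) * Real.exp x) * Real.exp x - -U (Real.exp x) * Real.exp x) /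
            Real.exp x ^ 2) +
          3 * sOf S x *
            ((deriv S (Real.exp x) * Real.exp x * (3 * Real.exp x) - S (Real.exp x) * (3 * Real.exp x)) /
              (3 * Real.exp x) ^ 2) -
          (r * wOf U x - wOf U x ^ 2 - 3 * sOf S x ^ 2) =
        (Real.exp x)⁻¹ * ((r - 1) * U (Real.exp x) + (Real.exp x + U (Real.exp x)) * deriv U (Real.exp x) +
          1 / 3 * S (Real.exp x) * deriv S (Real.exp x)) := by
      simp only [wOf, sOf]
      field_simp
      ring
    exact sub_eq_zero.1 (by rw [key, h1, mul_zero])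
  · -- mass = (BCG eq. 2)/(3ζ)
    have key : (1 - wOf U x) *
          ((deriv S (Real.exp x) * Real.exp x * (3 * Real.exp x) - S (Real.exp x) * (3 * Real.exp x)) /
            (3 * Real.exp x) ^ 2) -
          sOf S x / 3 *
            ((-(deriv U (Real.exp x) * Real.exp x) * Real.exp x - -U (Real.exp x) * Real.exp x) /
              Real.exp x ^ 2) -
          sOf S x * (2 * wOf U x - r) =
        (3 * Real.exp x)⁻¹ * ((r - 1) * S (Real.exp x) + (Real.exp x + U (Real.exp x)) * deriv S (Real.exp x) +
          1 / 3 * S (Real.exp x) * (deriv U (Real.exp x) + 2 * U (Real.exp x) / Real.exp x)) := by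
      simp only [wOf, sOf]
      field_simp
      ring
    exact sub_eq_zero.1 (by rw [key, h2, mul_zero])

/-- The window: `227/200 < 3 - √3` (`√3 < 1.865` since `3 < 1.865²`). [folklore] -/
theorem window_lt_rStar : (227 / 200 : ℝ) < 3 - Real.sqrt 3 := by
  have h : Real.sqrt 3 < 373 / 200 := by
    rw [Real.sqrt_lt' (by norm_num)]
    norm_num
  linarith

/-! ## The stub -/

/-- **Stub `stub_profile` of line `r2-one-mode-two-conditions`: THE SMOOTH PROFILE EXISTS.** From the named
fact `Literature.Analysis.FluidPDE.BuckmasterCaolaboraGomezserrano2025_thm11_monatomic` (BCG 2025 Thm 1.1 at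
`γ = 5/3`: a speed `r ∈ (1.10102, 1.13476)` and smooth radial profiles `U`, `S_BCG` of `ζ = R/(T-t)^{1/r}`
with `(r-1)U + (ζ+U)U' + (1/3)S S' = 0`, `(r-1)S + (ζ+U)S' + (1/3)S(U' + 2U/ζ) = 0`, `S > 0` on `[0,∞)`,
`U/ζ, S/ζ → 0`) by the change of variables `W(x) = -U(eˣ)/eˣ`, `S(x) = S_BCG(eˣ)/(3eˣ)` (`x = log ζ`):
there is a speed `r` with `11/10 < r < 227/200` and a profile `IsMonatomicProfile r W S`.
[cite: BuckmasterCaolaboraGomezserrano2025, Thm 1.1] -/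
theorem stub_profile :
    Literature.Analysis.FluidPDE.BuckmasterCaolaboraGomezserrano2025_thm11_monatomic →
    ∃ (r : ℝ) (W S : ℝ → ℝ), (11 / 10 < r ∧ r < 227 / 200) ∧ IsMonatomicProfile r W S := by
  rintro ⟨r, hr₃, hr₄, U, S, hU3, hS3, hode, hSpos, hUinf, hSinf⟩
  refine ⟨r, wOf U, sOf S, ⟨by linarith, by linarith⟩, by linarith, ?_, contDiff_wOf hU3,
    contDiff_sOf hS3, ?_, ?_, ?_, ?_, ?_⟩
  · -- `r < 3 - √3`
    exact lt_trans (by linarith) window_lt_rStar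
  · -- `S > 0`
    intro x
    have := hSpos (Real.exp x) (Real.exp_pos x).le
    simp only [sOf]
    positivity
  · -- the profile equations
    intro x
    have hζ : 0 < Real.exp x := Real.exp_pos x
    obtain ⟨h1, h2⟩ := hode (Real.exp x) hζ
    exact profileEqs_of_bcg (differentiableAt_of_radialField hU3 hζ)
      (differentiableAt_of_radialScalar hS3 hζ) h1 h2
  · -- centre regularity
    refine ⟨fun y => -((U ‖y‖ / ‖y‖) • y), fun y => S ‖y‖ / 3, hU3.neg, hS3.div_const 3, ?_, ?_⟩
    · have := hSpos ‖(0 : V3)‖ (norm_nonneg _)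
      positivity
    · intro y hy
      have hy' : 0 < ‖y‖ := norm_pos_iff.2 hy
      simp only [wOf, sOf, Real.exp_log hy']
      refine ⟨?_, ?_⟩
      · rw [neg_div, neg_smul]
      · field_simp
  · -- far field, `W → 0`
    have h := (hUinf.comp Real.tendsto_exp_atTop).neg
    rw [neg_zero] at h
    refine h.congr fun x => ?_
    simp only [Function.comp, wOf, neg_div]
  · -- far field, `S → 0`
    have h := (hSinf.comp Real.tendsto_exp_atTop).div_const 3
    rw [zero_div] at h
    refine h.congr fun x => ?_
    simp only [Function.comp, sOf]
    ring

end Summit.AtomisticToContinuum.HydrodynamicLimit.Theorems.R2OneModeTwoConditions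

end
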